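/-
Copyright (c) 2026 the pub-hodgecm-mathlib formalisation cell (harness21).  Prover seat hodgecm-mathlib-K2E3-p12 (g3), Track B «K2-LIT» ∕ h413
(`stmt-HodgeConjecture-24833`), line `K2_E3_EllipticInputs`, unit U12-d, §L (Lie-algebra cores), row 12: THE REGULAR UNIPOTENT AVERAGE
`Λ(f) = ∫_{GL₂(𝒪) × F} f(k n(x) k⁻¹)` ON `GL₂(F)` IS CONJUGATION-INVARIANT — Deligne–Rao's regular unipotent orbital integral, obtained as the
`|D|^{1∕2}`-normalised LIMIT of the split-torus orbital integrals (no Iwasawa cocycle needed).  2026-09-04.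
-/
import Literature.NumberTheory.Automorphic.GL2SplitTorusOrbitalLimit            -- ★ `GL2.exists_nhds_one_forall_splitTorusAverage_mul_eq`, `GL2.orbitalIntegral_diagGL2_eq_smul_central_average`
import Literature.NumberTheory.Automorphic.OrbitalIntegralSupportLocalisation   -- ★ `isLocSmooth_comp_conj`
import Literature.MeasureTheory.Group.InvariantQuotientExistence                -- ★ `exists_smulInvariantMeasure_integral_fiberIntegral_eq` (an invariant Radon measure on `G ⧸ A`)
import HarnessLib

/-!
# K2_E3 road (h413), §L at `N = 2` — the regular unipotent average of `GL₂(F)` is invariant under conjugation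

Cell `pub/hodgecm-mathlib` (D-0151), Track B (21-frontier RULING «PUSH BOTH» 2026-09-03, director req624), seat K2E3-p12 (g3), §L line lead; dealer
K2E3-plan (g2) deal (D20) (γ) 2026-09-04T01:52Z.  `--supports stmt-HodgeConjecture-24833 --as helper`; THEOREMS ONLY (no definition ∕ instance ∕
notation ∕ named fact ∕ `sorry`); never imports `Cruxes/…/Lines`.

For `f ∈ C_c^∞(GL₂(F))` put `Λ(f) := ∫_{K × F} f(k n(x) k⁻¹) d(κ ⊗ dx)` (`K = GL₂(𝒪)`, `n(x) = [[1,x],[0,1]]`, `κ`, `dx` Haar) — the regular unipotent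
orbital integral of `GL₂(F)` in Rao's `K × N` form [Rogawski1990, §8.1 p. 112 (`Λ_u`); HarishChandra1999, §3 (Deligne–Rao)].  The hard clause of «`Λ` is an
invariant distribution» is its invariance under conjugation by ALL of `GL₂(F)` (`K`-invariance is trivial); the textbook proof runs through the Iwasawa
cocycle `∫_K φ(κ(gk)) δ_B(β(gk))⁻¹ dk = ∫_K φ`.  Here it falls out of the tree's split-torus germ theory instead:
★ `GL2.orbitalIntegral_diagGL2_eq_smul_central_average` [Rogawski1990, §4.13 Lemma 4.13.1 (a); §8.1 Prop. 8.1.1] says that for every split-regular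
`γ = d(1, m)` close enough to `1` (how close depends on `f`), the orbital integral over the HOMOGENEOUS SPACE `GL₂(F) ⧸ A` with an invariant Radon measure
`μ_q` (★ `exists_smulInvariantMeasure_integral_fiberIntegral_eq`) is `Φ(γ, f) = C‖m − 1‖⁻¹ · Λ(f)` with `C > 0`; `Φ(γ, ·)` is conjugation-invariant for free
(★ `orbitalIntegral_conj_eq`), and `f ∘ Ad(x)` is again in `C_c^∞` (★ `isLocSmooth_comp_conj`), so choosing `γ` in both neighbourhoods gives
`Λ(f ∘ Ad(x)) = Λ(f)`.
* §1 `exists_units_ne_one_diagGL2_mem` — split-regular diagonal elements `d(1, m)`, `m ≠ 1`, exist in every neighbourhood of `1 ∈ GL₂(F)`.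
* §2 **`GL2.unipotentAverage_comp_conj_eq`** — `∫_{K×F} f(x (k n(t) k⁻¹) x⁻¹) = ∫_{K×F} f(k n(t) k⁻¹)` for every `x ∈ GL₂(F)` and every locally constant compactly
  supported `f : GL₂(F) → ℂ`.
The Lie-algebra version (`μ_reg(f) = ∫ f(k (tE₁₂) k⁻¹)` on `𝔤𝔩₂(F)`, an element of `J(𝒩)` that is not a multiple of `δ₀`) is the sequel file.
[Rogawski1990, §4.13 Lemma 4.13.1 (a) pp. 69–70; §8.1 p. 112, Prop. 8.1.1] [HarishChandra1999AdmissibleDistributions, §3 (orbital integrals on `𝒩`), Thm. 4.4]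
[DeitmarEchterhoff2014, Thm. 1.5.3].
HONEST LABEL: HC_CM is proved only modulo the 7 printed citations (2 remaining named inputs: hLiu418 = stmt-HodgeConjecture-24832, h413 =
stmt-HodgeConjecture-24833) until rung 0 closes; count-neutral helper toward (L-B_GL) at `N = 2`.

## References
* [Rogawski1990] J. D. Rogawski, *Automorphic Representations of Unitary Groups in Three Variables* (1990), §4.13 Lemma 4.13.1 (a), §8.1 Prop. 8.1.1.
* [HarishChandra1999AdmissibleDistributions] Harish-Chandra (DeBacker–Sally), *Admissible Invariant Distributions on Reductive p-adic Groups* (1999), §3, Thm. 4.4.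
* [DeitmarEchterhoff2014] A. Deitmar, S. Echterhoff, *Principles of Harmonic Analysis*, 2nd ed. (2014), Thm. 1.5.3.
-/

set_option autoImplicit false
set_option linter.dupNamespace false   -- `Summit.HodgeConjecture.HodgeConjecture.…` (D-0017 nested layout; lakefile exemption for Summits)

noncomputable section

open MeasureTheory Measure Filter Topology
open scoped MatrixGroups NNReal ENNReal
open Literature.NumberTheory.Rogawski1990 Literature.NumberTheory.Automorphic Literature.MeasureTheory.Group
open Literature.NumberTheory.GaloisRepresentations Literature.NumberTheory.GaloisRepresentations.IsNonarchimedeanLocalField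

namespace Summit.HodgeConjecture.HodgeConjecture.Cruxes.H413.K2E3GL2UnipotentAverageConjInvariant

variable {F : Type*} [Field F] [ValuativeRel F] [TopologicalSpace F] [IsNonarchimedeanLocalField F]

/-! ## §1  Split-regular diagonal elements near `1` -/

/-- **Split-regular diagonal elements `d(1, m)`, `m ≠ 1`, exist in every neighbourhood of `1 ∈ GL₂(F)`** (`m = 1 + a` with `0 < ‖a‖ = q^{-n}` small:
★ `exists_unitFiltration_subset`, ★ `exists_normAbs_eq_inv_zpow_of_int`, ★ `continuous_diagGL2`). [cite: Rogawski1990, §8.1 p. 112] -/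
theorem exists_units_ne_one_diagGL2_mem {W : Set (GL (Fin 2) F)} (hW : W ∈ 𝓝 (1 : GL (Fin 2) F)) :
    ∃ m : Fˣ, m ≠ 1 ∧ diagGL2 1 m ∈ W := by
  -- pull `W` back to a neighbourhood of `1 ∈ Fˣ` along `m ↦ d(1, m)`
  have hcont : Continuous fun m : Fˣ => diagGL2 (1 : Fˣ) m :=
    continuous_diagGL2.comp (continuous_const.prodMk continuous_id)
  have hW' : (fun m : Fˣ => diagGL2 (1 : Fˣ) m) ⁻¹' W ∈ 𝓝 (1 : Fˣ) := by
    refine hcont.continuousAt.preimage_mem_nhds ?_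
    rw [diagGL2_one]
    exact hW
  obtain ⟨n, hn, hsub⟩ := exists_unitFiltration_subset hW'
  -- `m = 1 + a` with `‖a‖ = q^{-n}`
  obtain ⟨a, ha0, ha⟩ := exists_normAbs_eq_inv_zpow_of_int (F := F) (n : ℤ)
  have hlt : normAbs F a < 1 := by
    rw [ha, zpow_natCast]
    exact pow_lt_one₀ inv_residueFieldCard_pos.le inv_residueFieldCard_lt_one (by omega)
  have h1a : (1 : F) + a ≠ 0 := by
    intro h
    have : a = -1 := by linear_combination h
    rw [this, normAbs_neg, map_one] at hlt
    exact lt_irrefl _ hlt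
  refine ⟨Units.mk0 (1 + a) h1a, fun h => ha0 ?_, hsub ((mem_unitFiltration_iff_sub_one_mem hn _).2 ?_)⟩
  · have h' := congrArg (fun u : Fˣ => (u : F)) h
    simp only [Units.val_mk0, Units.val_one] at h'
    linear_combination h'
  · rw [Units.val_mk0, add_sub_cancel_left, mem_primePowBall_iff, ha]

/-! ## §2  Conjugation invariance of the regular unipotent average -/

section Average

variable [SecondCountableTopology F] [MeasurableSpace F] [BorelSpace F]
  [MeasurableSpace (GL (Fin 2) F)] [BorelSpace (GL (Fin 2) F)] [SecondCountableTopology (GL (Fin 2) F)]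
  (κ : Measure ↥(glInt 2 F)) [IsHaarMeasure κ] (dx : Measure F) [dx.IsAddHaarMeasure]

set_option maxHeartbeats 1600000 in
/-- **The regular unipotent average `Λ(f) = ∫_{GL₂(𝒪)×F} f(k n(t) k⁻¹) d(κ ⊗ dx)` is invariant under conjugation by `GL₂(F)`**: for every `x ∈ GL₂(F)` and
every locally constant compactly supported `f : GL₂(F) → ℂ`, `Λ(f ∘ Ad x) = Λ(f)`.  Proof through the split torus: for `γ = d(1, m)` split-regular and close
to `1`, `Φ(γ, f) = C‖m − 1‖⁻¹ Λ(f)` and `Φ(γ, f ∘ Ad x) = C‖m − 1‖⁻¹ Λ(f ∘ Ad x)` (★ `GL2.orbitalIntegral_diagGL2_eq_smul_central_average` at the centre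
`z = 1`, for an invariant Radon measure on `GL₂(F) ⧸ A`, ★ `exists_smulInvariantMeasure_integral_fiberIntegral_eq`), while `Φ(γ, f ∘ Ad x) = Φ(γ, f)`
(★ `orbitalIntegral_conj_eq`). [cite: Rogawski1990, §4.13 Lemma 4.13.1 (a) pp. 69–70; §8.1 p. 112, Prop. 8.1.1] [cite: HarishChandra1999AdmissibleDistributions, §3 p. 9] -/
theorem GL2.unipotentAverage_comp_conj_eq {f : GL (Fin 2) F → ℂ} (hlc : IsLocallyConstant f) (hcs : HasCompactSupport f) (x : GL (Fin 2) F) :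
    ∫ p : ↥(glInt 2 F) × F, f (x * ((p.1 : GL (Fin 2) F) *
        ((unipotentGL2 p.2 : ↥(upperUnitriangular (Fin 2) F)) : GL (Fin 2) F) * (p.1 : GL (Fin 2) F)⁻¹) * x⁻¹) ∂(κ.prod dx) =
      ∫ p : ↥(glInt 2 F) × F, f ((p.1 : GL (Fin 2) F) *
        ((unipotentGL2 p.2 : ↥(upperUnitriangular (Fin 2) F)) : GL (Fin 2) F) * (p.1 : GL (Fin 2) F)⁻¹) ∂(κ.prod dx) := by
  classical
  haveI : T2Space F := (isLocalField F).toT2Space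
  haveI : LocallyCompactSpace F := (isLocalField F).toLocallyCompactSpace
  haveI : T2Space (GL (Fin 2) F) := t2Space_generalLinearGroup F 2
  haveI : LocallyCompactSpace (GL (Fin 2) F) := locallyCompactSpace_generalLinearGroup F 2
  -- `f ∘ Ad x` is again locally constant with compact support
  set f' : GL (Fin 2) F → ℂ := f ∘ MulAut.conj x with hf'
  have hsm' : IsLocSmooth f' := by
    have h := isLocSmooth_comp_conj (⟨hlc, hcs⟩ : IsLocSmooth f) x
    refine (show f' = fun g => f (x * g * x⁻¹) from funext fun g => ?_) ▸ h
    simp only [hf', Function.comp_apply, MulAut.conj_apply]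
  -- the two local-constancy neighbourhoods and a split-regular `γ = d(1, m)` in both
  obtain ⟨V, hV1, hV⟩ := GL2.exists_nhds_one_forall_splitTorusAverage_mul_eq F κ dx hlc hcs
  obtain ⟨V', hV1', hV'⟩ := GL2.exists_nhds_one_forall_splitTorusAverage_mul_eq F κ dx hsm'.1 hsm'.2
  obtain ⟨m, hm1, hmV⟩ := exists_units_ne_one_diagGL2_mem (Filter.inter_mem hV1 hV1')
  have h : (1 : Fˣ) ≠ m := fun e => hm1 e.symm
  -- the homogeneous space `GL₂(F) ⧸ A`, `A = C(γ)`, and an invariant Radon measure on it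
  set A : Subgroup (GL (Fin 2) F) := Subgroup.centralizer ({diagGL2 (1 : Fˣ) m} : Set (GL (Fin 2) F)) with hAdef
  have hA : IsClosed ((A : Subgroup (GL (Fin 2) F)) : Set (GL (Fin 2) F)) := Set.isClosed_centralizer _
  letI : MeasurableSpace (GL (Fin 2) F ⧸ A) := borel _
  haveI : BorelSpace (GL (Fin 2) F ⧸ A) := ⟨rfl⟩
  haveI : BorelSpace ↥A := Subtype.borelSpace _
  haveI : LocallyCompactSpace ↥A := hA.locallyCompactSpace
  haveI : SecondCountableTopology ↥A := TopologicalSpace.Subtype.secondCountableTopology _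
  letI : CommGroup ↥A :=
    { (inferInstance : Group ↥A) with
      mul_comm := fun a b => Subtype.ext (by
        obtain ⟨a₀, a₁, ha⟩ := (GL2.mem_centralizer_diagGL2_iff h (a : GL (Fin 2) F)).1 a.2
        obtain ⟨b₀, b₁, hb⟩ := (GL2.mem_centralizer_diagGL2_iff h (b : GL (Fin 2) F)).1 b.2
        change (a : GL (Fin 2) F) * b = b * a
        rw [ha, hb]
        exact GL2.diagGL2_mul_comm _ _ _ _) }
  haveI : (haar : Measure (GL (Fin 2) F)).IsMulRightInvariant := isMulRightInvariant_generalLinearGroup _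
  haveI : (haar : Measure ↥A).IsInvInvariant := inferInstance
  obtain ⟨μq, hμinv, hμreg, hμ0, -⟩ :=
    exists_smulInvariantMeasure_integral_fiberIntegral_eq A (haar : Measure ↥A) hA (haar : Measure (GL (Fin 2) F))
  haveI := hμinv
  haveI := hμreg
  -- the split-torus orbital integral at `γ`, for `f` and for `f ∘ Ad x`
  obtain ⟨C, hC0, -, hC⟩ := GL2.exists_orbitalIntegral_diagGL2_eq_smul_integral h μq hμ0 κ dx (E := ℂ)
  have hz : ∀ y : GL (Fin 2) F, y * 1 * y⁻¹ = 1 := fun y => by simp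
  have hmem : diagGL2 (1 : Fˣ) m * (1 : GL (Fin 2) F)⁻¹ ∈ V := by simpa using hmV.1
  have hmem' : diagGL2 (1 : Fˣ) m * (1 : GL (Fin 2) F)⁻¹ ∈ V' := by simpa using hmV.2
  have e1 := GL2.orbitalIntegral_diagGL2_eq_smul_central_average μq κ dx (hC f hlc.continuous hcs) hV hz hmem
  have e2 := GL2.orbitalIntegral_diagGL2_eq_smul_central_average μq κ dx (hC f' hsm'.1.continuous hsm'.2) hV' hz hmem'
  -- conjugation invariance of the orbital integral
  have hinv : orbitalIntegral (diagGL2 (1 : Fˣ) m) f' μq = orbitalIntegral (diagGL2 (1 : Fˣ) m) f μq :=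
    orbitalIntegral_conj_eq _ μq x f
  rw [e1, e2] at hinv
  -- cancel the non-zero scalar `C ‖m − 1‖⁻¹`
  have hm1' : normAbs F ((((1 : Fˣ)⁻¹ : Fˣ) : F) * m - 1) ≠ 0 := by
    rw [inv_one, Units.val_one, one_mul]
    intro h0
    apply hm1
    exact Units.ext (sub_eq_zero.1 ((map_eq_zero (normAbs F)).1 h0))
  have hc : (((C * (normAbs F ((((1 : Fˣ)⁻¹ : Fˣ) : F) * m - 1))⁻¹ : ℝ≥0) : ℝ)) ≠ 0 := by
    rw [NNReal.coe_ne_zero]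
    exact mul_ne_zero hC0 (inv_ne_zero hm1')
  have hcancel := smul_right_injective ℂ hc hinv
  simpa only [hf', Function.comp_apply, MulAut.conj_apply, one_mul] using hcancel

end Average

end Summit.HodgeConjecture.HodgeConjecture.Cruxes.H413.K2E3GL2UnipotentAverageConjInvariant

end
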